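import Literature.MathematicalPhysics.QuantumLattice.ClusterPairBosonCouplings
import Literature.MathematicalPhysics.QuantumLattice.SectorRelativeClustering
import Literature.MathematicalPhysics.QuantumLattice.LiebRobinsonHastingsKomaSpectralProofs
import Literature.MathematicalPhysics.QuantumLattice.ApproximateEigenvectorLemmas
import HarnessLib

/-!
# Crux `DressHalfFilled` (stmt-HubbardSuperconductivity-8148, route `LevyLogBootstrap`; shared with route
# `AnisotropyChord`): Kato's two-body resolvent kernel `pairResolvent` as the solution of a block Sylvester equation

Support file (`--supports stmt-HubbardSuperconductivity-8148`) for STUB 1 `stub_plaquetteData`, whose only clause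
not yet proved in the tree is (W1), the window `0 < J(U)`, `0 ≤ V(U) < 2J(U)` of the second-order pair-boson
couplings (`plaquettePairCouplings`; `stub_plaquetteData_of_kernelWindow` in `…DressHalfFilledPlaquetteData`).
`J`, `V` are finite sums of values of `pairResolvent hA E a b c d = Σ_{μ,ν} ⟨a,u_μ⟩⟨u_μ,b⟩⟨c,u_ν⟩⟨u_ν,d⟩ /
(λ_μ + λ_ν - E)` (`ClusterPairBosonCouplings`) over Mathlib's (non-computable, arbitrarily ordered) eigenbasis of the
256-dimensional plaquette Hamiltonian. This file proves the GENERIC linear algebra that turns such a value into a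
kernel-checkable certificate, for any Hermitian `H : Matrix m m ℂ`, two COORDINATE BLOCKS `p₁, p₂` of `H`
(`H j k = 0` from outside into the block), form floors `θ₁ ‖u‖² ≤ Re⟨u,Hu⟩` on `p₁`, `θ₂ ‖u‖² ≤ Re⟨u,Hu⟩` on `p₂`,
an energy `E < θ₁ + θ₂`, and vectors `a, b` supported on `p₁`, `c, d` supported on `p₂`:

* `pairResolvent_eq_pairing_solution` — `pairResolvent hH E a b c d = Σ_{ij} ā_i c̄_j X_{ij}` for the
  block-projected spectral sum `X = Σ_{μν} (λ_μ+λ_ν-E)⁻¹ ⟨u_μ,b⟩⟨u_ν,d⟩ (𝟙_{p₁}u_μ)(𝟙_{p₂}u_ν)ᵀ` (pure algebra: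
  `a` does not see the complement of `p₁`);
* `sylvester_pairingSolution` — `X` solves the Sylvester equation `H X + X Hᵀ - E X = b dᵀ` (block-truncated
  eigenvectors are eigenvectors, `eigenvalue_ge_of_block` excludes resonances `λ_μ + λ_ν = E` — so Lean's
  `0⁻¹ = 0` convention never bites — and completeness of the eigenbasis);
* `sylvester_coercive` — `(θ₁+θ₂-E) ‖Z‖_F² ≤ Re⟨Z, H Z + Z Hᵀ - E Z⟩_F` on matrices supported on `p₁ × p₂`
  (columns see `θ₁`, rows see `θ₂`), hence `(θ₁+θ₂-E)² ‖Z‖_F² ≤ ‖H Z + Z Hᵀ - E Z‖_F²`;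
* `pairResolvent_certificate` — for ANY trial matrix `Y` supported on `p₁ × p₂`,
  `(θ₁+θ₂-E) · |pairResolvent hH E a b c d - Σ_{ij} ā_i c̄_j Y_{ij}| ≤ ‖a‖ ‖c‖ ‖b dᵀ - (H Y + Y Hᵀ - E Y)‖_F`:
  the kernel only has to evaluate a residual; and `norm_pairResolvent_le` (`Y = 0`):
  `(θ₁+θ₂-E) |pairResolvent| ≤ ‖a‖ ‖b‖ ‖c‖ ‖d‖`.

Sources: T. Kato, *Perturbation Theory for Linear Operators* (1966) I-§5.3 (reduced resolvent); W.-F. Tsai,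
S. A. Kivelson, PRB 73 (2006) 214510, App. A (the second-order sums); the a-posteriori bound is elementary
(Lax–Milgram / residual) linear algebra. No definition and no named fact is introduced; sorry-free.
-/

noncomputable section

set_option linter.dupNamespace false

namespace Summit.HubbardSuperconductivity.HubbardSuperconductivity.Theorems.LevyLogBootstrap

open Matrix Finset Literature.MathematicalPhysics.QuantumLattice
open scoped ComplexOrder

section Generic

variable {m : Type*} [Fintype m] [DecidableEq m]

/-! ### Small algebra: supports, indicators, Frobenius pairing -/

omit [DecidableEq m] in
/-- `⟨a, 𝟙_p v⟩ = ⟨a, v⟩` when `a` vanishes off `p`. [folklore] -/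
theorem star_dotProduct_indicator_of_support (p : m → Prop) [DecidablePred p] {a : m → ℂ}
    (ha : ∀ j, ¬ p j → a j = 0) (v : m → ℂ) :
    star a ⬝ᵥ (fun j => if p j then v j else 0) = star a ⬝ᵥ v := by
  simp only [dotProduct, Pi.star_apply]
  refine Finset.sum_congr rfl fun j _ => ?_
  by_cases hj : p j
  · rw [if_pos hj]
  · rw [if_neg hj, ha j hj, star_zero, zero_mul, zero_mul]

omit [Fintype m] [DecidableEq m] in
/-- A vector supported on `p` equals its truncation to `p`. [folklore] -/
theorem indicator_eq_self_of_support (p : m → Prop) [DecidablePred p] {v : m → ℂ}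
    (hv : ∀ j, ¬ p j → v j = 0) : (fun j => if p j then v j else 0) = v := by
  funext j
  by_cases hj : p j
  · rw [if_pos hj]
  · rw [if_neg hj, hv j hj]

omit [DecidableEq m] in
/-- `Re ⟨v, v⟩ = Σ ‖v j‖²`. [folklore] -/
theorem star_dotProduct_self_re_eq_sum (v : m → ℂ) : (star v ⬝ᵥ v).re = ∑ j, ‖v j‖ ^ 2 := by
  simp only [dotProduct, Pi.star_apply, Complex.re_sum]
  refine Finset.sum_congr rfl fun j _ => ?_
  rw [Complex.star_def, Complex.conj_mul', ← Complex.ofReal_pow, Complex.ofReal_re]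

omit [DecidableEq m] in
/-- The Frobenius pairing with a rank-one matrix: `Σ_{ij} ā_i c̄_j Z_{ij} = ⟨a ⊗ c, Z⟩` as a `dotProduct` on
`m × m`. [folklore] -/
theorem pairing_eq_dotProduct (a c : m → ℂ) (Z : Matrix m m ℂ) :
    ∑ i, ∑ j, star (a i) * star (c j) * Z i j =
      star (fun ij : m × m => a ij.1 * c ij.2) ⬝ᵥ (fun ij : m × m => Z ij.1 ij.2) := by
  rw [dotProduct, Fintype.sum_prod_type]
  refine Finset.sum_congr rfl fun i _ => Finset.sum_congr rfl fun j _ => ?_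
  simp only [Pi.star_apply, star_mul']

omit [DecidableEq m] in
/-- `‖a ⊗ c‖ = ‖a‖ ‖c‖` (Euclidean norms). [folklore] -/
theorem eucNorm_tensor (a c : m → ℂ) :
    eucNorm (fun ij : m × m => a ij.1 * c ij.2) = eucNorm a * eucNorm c := by
  have h2 : eucNorm (fun ij : m × m => a ij.1 * c ij.2) ^ 2 = (eucNorm a * eucNorm c) ^ 2 := by
    rw [mul_pow, eucNorm_sq, eucNorm_sq, eucNorm_sq, star_dotProduct_self_re_eq_sum,
      star_dotProduct_self_re_eq_sum, star_dotProduct_self_re_eq_sum, Fintype.sum_prod_type,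
      Finset.sum_mul_sum]
    refine Finset.sum_congr rfl fun i _ => Finset.sum_congr rfl fun j _ => ?_
    rw [norm_mul, mul_pow]
  exact (pow_left_inj₀ (eucNorm_nonneg _) (mul_nonneg (eucNorm_nonneg _) (eucNorm_nonneg _))
    two_ne_zero).1 h2

omit [DecidableEq m] in
/-- The Frobenius norm of a rank-one matrix: `‖b dᵀ‖_F = ‖b‖ ‖d‖`. [folklore] -/
theorem eucNorm_vecMulVec (b d : m → ℂ) :
    eucNorm (fun ij : m × m => vecMulVec b d ij.1 ij.2) = eucNorm b * eucNorm d := by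
  simp only [vecMulVec_apply]
  exact eucNorm_tensor b d

/-! ### Block-truncated eigenvectors -/

omit [DecidableEq m] in
/-- **A coordinate block of `H` is invariant**: if `H` has no entries from outside `p` into `p` (and hence, by
Hermiticity, none back), the truncation `𝟙_p v` of an eigenvector `Hv = λv` is again an eigenvector with the
same eigenvalue (or zero). [folklore] -/
theorem mulVec_indicator_of_eigenvector {H : Matrix m m ℂ} (hH : H.IsHermitian) (p : m → Prop)
    [DecidablePred p] (hblock : ∀ j k, ¬ p j → p k → H j k = 0) {v : m → ℂ} {lam : ℂ}
    (hv : H *ᵥ v = lam • v) :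
    H *ᵥ (fun j => if p j then v j else 0) = lam • (fun j => if p j then v j else 0) := by
  have hblock' : ∀ j k, p j → ¬ p k → H j k = 0 := by
    intro j k hj hk
    have h := hblock k j hk hj
    have := congrFun (congrFun hH.eq j) k
    rw [conjTranspose_apply, h, star_zero] at this
    exact this.symm
  funext j
  by_cases hj : p j
  · have hvj := congrFun hv j
    simp only [mulVec, dotProduct, Pi.smul_apply, smul_eq_mul] at hvj ⊢
    rw [if_pos hj, ← hvj]
    refine Finset.sum_congr rfl fun k _ => ?_
    by_cases hk : p k
    · rw [if_pos hk]
    · rw [if_neg hk, hblock' j k hj hk, zero_mul, zero_mul]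
  · simp only [mulVec, dotProduct, Pi.smul_apply, smul_eq_mul, if_neg hj, mul_zero]
    refine Finset.sum_eq_zero fun k _ => ?_
    by_cases hk : p k
    · rw [hblock j k hj hk, zero_mul]
    · rw [if_neg hk, mul_zero]

omit [DecidableEq m] in
/-- **No resonance below the floor**: if the block `p` carries the form floor `θ ‖u‖² ≤ Re⟨u, Hu⟩` and an
eigenvector of eigenvalue `λ` has a nonzero component in the block, then `θ ≤ λ` (`eigenvalue_ge_of_block`).
[folklore] -/
theorem floor_le_eigenvalue_of_indicator_ne_zero {H : Matrix m m ℂ} (hH : H.IsHermitian) (p : m → Prop)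
    [DecidablePred p] (hblock : ∀ j k, ¬ p j → p k → H j k = 0) {θ : ℝ}
    (hθ : ∀ u : m → ℂ, (∀ j, ¬ p j → u j = 0) → θ * (star u ⬝ᵥ u).re ≤ (star u ⬝ᵥ H *ᵥ u).re)
    {v : m → ℂ} {lam : ℝ} (hv : H *ᵥ v = (lam : ℂ) • v)
    (hne : (fun j => if p j then v j else 0) ≠ 0) : θ ≤ lam := by
  refine eigenvalue_ge_of_block hH p hblock (fun u hu hu1 => ?_) hv ?_
  · have := hθ u hu
    rw [hu1, Complex.one_re, mul_one] at this
    exact this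
  · by_contra h
    apply hne
    funext j
    by_cases hj : p j
    · rw [if_pos hj]
      by_contra hvj
      exact h ⟨j, hj, hvj⟩
    · rw [if_neg hj]; rfl

/-! ### The block-projected spectral solution of the Sylvester equation -/

omit [DecidableEq m] in
/-- Reordering of a fourfold sum. [folklore] -/
theorem sum_comm_four' {α β γ δ : Type*} [Fintype α] [Fintype β] [Fintype γ] [Fintype δ]
    (f : α → β → γ → δ → ℂ) :
    ∑ i, ∑ j, ∑ μ, ∑ ν, f i j μ ν = ∑ μ, ∑ ν, ∑ i, ∑ j, f i j μ ν :=
  calc ∑ i, ∑ j, ∑ μ, ∑ ν, f i j μ ν = ∑ i, ∑ μ, ∑ j, ∑ ν, f i j μ ν :=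
        Finset.sum_congr rfl fun _ _ => Finset.sum_comm
    _ = ∑ μ, ∑ i, ∑ j, ∑ ν, f i j μ ν := Finset.sum_comm
    _ = ∑ μ, ∑ i, ∑ ν, ∑ j, f i j μ ν :=
        Finset.sum_congr rfl fun _ _ => Finset.sum_congr rfl fun _ _ => Finset.sum_comm
    _ = ∑ μ, ∑ ν, ∑ i, ∑ j, f i j μ ν := Finset.sum_congr rfl fun _ _ => Finset.sum_comm

omit [DecidableEq m] in
/-- The Frobenius pairing of `a ⊗ c` with a combination of rank-one matrices:
`Σ_{ij} ā_i c̄_j (Σ_{μν} k_{μν} u_μ v_νᵀ)_{ij} = Σ_{μν} k_{μν} ⟨a, u_μ⟩ ⟨c, v_ν⟩`. [folklore] -/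
theorem pairing_sum_smul_vecMulVec {κ : Type*} [Fintype κ] (a c : m → ℂ) (k : κ → κ → ℂ)
    (u v : κ → m → ℂ) :
    ∑ i, ∑ j, star (a i) * star (c j) * (∑ μ, ∑ ν, k μ ν • vecMulVec (u μ) (v ν)) i j =
      ∑ μ, ∑ ν, k μ ν * ((star a ⬝ᵥ u μ) * (star c ⬝ᵥ v ν)) := by
  simp only [Matrix.sum_apply, Matrix.smul_apply, vecMulVec_apply, smul_eq_mul, dotProduct,
    Pi.star_apply, Finset.mul_sum, Finset.sum_mul]
  rw [sum_comm_four' (fun i j μ ν => star (a i) * star (c j) * (k μ ν * (u μ i * v ν j)))]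
  refine Finset.sum_congr rfl fun μ _ => Finset.sum_congr rfl fun ν _ => ?_
  rw [Finset.sum_comm]
  refine Finset.sum_congr rfl fun i _ => Finset.sum_congr rfl fun j _ => ?_
  ring

section Sylvester

/-- **The pair resolvent as a Frobenius pairing.** For `a` supported on `p₁` and `c` supported on `p₂`,
`pairResolvent hH E a b c d = Σ_{ij} ā_i c̄_j X_{ij}` with the block-projected spectral sum
`X = Σ_{μν} (λ_μ+λ_ν-E)⁻¹ ⟨u_μ,b⟩⟨u_ν,d⟩ · (𝟙_{p₁}u_μ) (𝟙_{p₂}u_ν)ᵀ` (pure algebra: `a` and `c` do not see the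
complements of their blocks). [folklore] -/
theorem pairResolvent_eq_pairing_solution {H : Matrix m m ℂ} (hH : H.IsHermitian) (p₁ p₂ : m → Prop) [DecidablePred p₁]
    [DecidablePred p₂] (E : ℝ) {a : m → ℂ} (ha : ∀ j, ¬ p₁ j → a j = 0) (b : m → ℂ)
    {c : m → ℂ} (hc : ∀ j, ¬ p₂ j → c j = 0) (d : m → ℂ) (X : Matrix m m ℂ)
    (hX : X = ∑ μ, ∑ ν, ((((hH.eigenvalues μ + hH.eigenvalues ν - E : ℝ) : ℂ))⁻¹ *
        (star ⇑(hH.eigenvectorBasis μ) ⬝ᵥ b) * (star ⇑(hH.eigenvectorBasis ν) ⬝ᵥ d)) •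
      vecMulVec (fun j => if p₁ j then (⇑(hH.eigenvectorBasis μ) : m → ℂ) j else 0)
        (fun j => if p₂ j then (⇑(hH.eigenvectorBasis ν) : m → ℂ) j else 0)) :
    pairResolvent hH E a b c d = ∑ i, ∑ j, star (a i) * star (c j) * X i j := by
  rw [hX, pairing_sum_smul_vecMulVec, pairResolvent]
  refine Finset.sum_congr rfl fun μ _ => Finset.sum_congr rfl fun ν _ => ?_
  rw [star_dotProduct_indicator_of_support p₁ ha, star_dotProduct_indicator_of_support p₂ hc]
  ring

/-- The eigenvector equation in `ℂ`-scalar form. [folklore] -/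
theorem mulVec_eigenvectorBasis_coe {H : Matrix m m ℂ} (hH : H.IsHermitian) (μ : m) :
    H *ᵥ (⇑(hH.eigenvectorBasis μ) : m → ℂ) = ((hH.eigenvalues μ : ℝ) : ℂ) • (⇑(hH.eigenvectorBasis μ) : m → ℂ) := by
  rw [hH.mulVec_eigenvectorBasis μ, RCLike.real_smul_eq_coe_smul (K := ℂ)]
  rfl

/-- The Sylvester operator on one block-truncated rank-one piece:
`H (t₁u_μ)(t₂u_ν)ᵀ + (t₁u_μ)(t₂u_ν)ᵀ Hᵀ - E (t₁u_μ)(t₂u_ν)ᵀ = (λ_μ + λ_ν - E) (t₁u_μ)(t₂u_ν)ᵀ`. [folklore] -/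
theorem sylvester_piece {H : Matrix m m ℂ} (hH : H.IsHermitian) (p₁ p₂ : m → Prop) [DecidablePred p₁]
    [DecidablePred p₂] (hK₁ : ∀ j k, ¬ p₁ j → p₁ k → H j k = 0) (hK₂ : ∀ j k, ¬ p₂ j → p₂ k → H j k = 0)
    (E : ℝ) (μ ν : m) :
    H * vecMulVec (fun j => if p₁ j then (⇑(hH.eigenvectorBasis μ) : m → ℂ) j else 0) (fun j => if p₂ j then (⇑(hH.eigenvectorBasis ν) : m → ℂ) j else 0) + vecMulVec (fun j => if p₁ j then (⇑(hH.eigenvectorBasis μ) : m → ℂ) j else 0) (fun j => if p₂ j then (⇑(hH.eigenvectorBasis ν) : m → ℂ) j else 0) * Hᵀ -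
        (E : ℂ) • vecMulVec (fun j => if p₁ j then (⇑(hH.eigenvectorBasis μ) : m → ℂ) j else 0) (fun j => if p₂ j then (⇑(hH.eigenvectorBasis ν) : m → ℂ) j else 0) =
      (((hH.eigenvalues μ + hH.eigenvalues ν - E : ℝ) : ℂ)) • vecMulVec (fun j => if p₁ j then (⇑(hH.eigenvectorBasis μ) : m → ℂ) j else 0) (fun j => if p₂ j then (⇑(hH.eigenvectorBasis ν) : m → ℂ) j else 0) := by
  rw [mul_vecMulVec, vecMulVec_mul, vecMul_transpose,
    mulVec_indicator_of_eigenvector hH p₁ hK₁ (mulVec_eigenvectorBasis_coe hH μ),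
    mulVec_indicator_of_eigenvector hH p₂ hK₂ (mulVec_eigenvectorBasis_coe hH ν), smul_vecMulVec,
    vecMulVec_smul]
  push_cast
  simp only [sub_smul, add_smul]

/-- No resonance on a present piece: `(λ_μ + λ_ν - E)⁻¹ (λ_μ + λ_ν - E) · (t₁u_μ)(t₂u_ν)ᵀ = (t₁u_μ)(t₂u_ν)ᵀ`
(if either truncation vanishes both sides are `0`; otherwise `λ_μ ≥ θ₁`, `λ_ν ≥ θ₂` by the floors, so the
scalar is `1`). [folklore] -/
theorem sylvester_piece_coef {H : Matrix m m ℂ} (hH : H.IsHermitian) (p₁ p₂ : m → Prop) [DecidablePred p₁]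
    [DecidablePred p₂] (hK₁ : ∀ j k, ¬ p₁ j → p₁ k → H j k = 0)
    (hK₂ : ∀ j k, ¬ p₂ j → p₂ k → H j k = 0) {θ₁ θ₂ E : ℝ}
    (hθ₁ : ∀ u : m → ℂ, (∀ j, ¬ p₁ j → u j = 0) → θ₁ * (star u ⬝ᵥ u).re ≤ (star u ⬝ᵥ H *ᵥ u).re)
    (hθ₂ : ∀ u : m → ℂ, (∀ j, ¬ p₂ j → u j = 0) → θ₂ * (star u ⬝ᵥ u).re ≤ (star u ⬝ᵥ H *ᵥ u).re)
    (hE : E < θ₁ + θ₂) (μ ν : m) :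
    ((((hH.eigenvalues μ + hH.eigenvalues ν - E : ℝ) : ℂ))⁻¹ *
        (((hH.eigenvalues μ + hH.eigenvalues ν - E : ℝ) : ℂ))) • vecMulVec (fun j => if p₁ j then (⇑(hH.eigenvectorBasis μ) : m → ℂ) j else 0) (fun j => if p₂ j then (⇑(hH.eigenvectorBasis ν) : m → ℂ) j else 0) =
      vecMulVec (fun j => if p₁ j then (⇑(hH.eigenvectorBasis μ) : m → ℂ) j else 0) (fun j => if p₂ j then (⇑(hH.eigenvectorBasis ν) : m → ℂ) j else 0) := by
  by_cases h1 : (fun j => if p₁ j then (⇑(hH.eigenvectorBasis μ) : m → ℂ) j else 0) = 0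
  · rw [h1, zero_vecMulVec, smul_zero]
  by_cases h2 : (fun j => if p₂ j then (⇑(hH.eigenvectorBasis ν) : m → ℂ) j else 0) = 0
  · rw [h2, vecMulVec_zero, smul_zero]
  have l1 := floor_le_eigenvalue_of_indicator_ne_zero hH p₁ hK₁ hθ₁ (mulVec_eigenvectorBasis_coe hH μ) h1
  have l2 := floor_le_eigenvalue_of_indicator_ne_zero hH p₂ hK₂ hθ₂ (mulVec_eigenvectorBasis_coe hH ν) h2
  have hpos : (hH.eigenvalues μ + hH.eigenvalues ν - E : ℝ) ≠ 0 := by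
    intro h0; linarith
  rw [inv_mul_cancel₀ (by exact_mod_cast hpos), one_smul]

/-- Completeness of the eigenbasis, truncated to a block: `Σ_μ ⟨u_μ, b⟩ · t₁u_μ = 𝟙_{p₁} b`. [folklore] -/
theorem sum_dotProduct_smul_truncEig {H : Matrix m m ℂ} (hH : H.IsHermitian) (p₁ : m → Prop) [DecidablePred p₁] (b : m → ℂ) :
    ∑ μ, (star ⇑(hH.eigenvectorBasis μ) ⬝ᵥ b) • (fun j => if p₁ j then (⇑(hH.eigenvectorBasis μ) : m → ℂ) j else 0) =
      fun j => if p₁ j then b j else 0 := by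
  funext j
  simp only [Finset.sum_apply, Pi.smul_apply, smul_eq_mul]
  by_cases hj : p₁ j
  · simp only [if_pos hj]
    have := congrFun (sum_dotProduct_smul_eigenvectorBasis hH b) j
    simp only [Finset.sum_apply, Pi.smul_apply, smul_eq_mul] at this
    exact this
  · simp only [if_neg hj, mul_zero, Finset.sum_const_zero]

/-- **The block-projected spectral sum solves the Sylvester equation** `H X + X Hᵀ - E X = (𝟙_{p₁}b)(𝟙_{p₂}d)ᵀ`
(= `b dᵀ` for `b` supported on `p₁`, `d` supported on `p₂`), for blocks `p₁, p₂` of `H` with form floors `θ₁, θ₂`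
and `E < θ₁ + θ₂`
(no resonance: an eigenvector with a nonzero component in `pᵢ` has eigenvalue `≥ θᵢ`, so `λ_μ + λ_ν - E > 0`
whenever the `(μ, ν)` term is present — Lean's `0⁻¹ = 0` is never used). [folklore] -/
theorem sylvester_pairingSolution {H : Matrix m m ℂ} (hH : H.IsHermitian) (p₁ p₂ : m → Prop) [DecidablePred p₁]
    [DecidablePred p₂] (hK₁ : ∀ j k, ¬ p₁ j → p₁ k → H j k = 0)
    (hK₂ : ∀ j k, ¬ p₂ j → p₂ k → H j k = 0) {θ₁ θ₂ E : ℝ}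
    (hθ₁ : ∀ u : m → ℂ, (∀ j, ¬ p₁ j → u j = 0) → θ₁ * (star u ⬝ᵥ u).re ≤ (star u ⬝ᵥ H *ᵥ u).re)
    (hθ₂ : ∀ u : m → ℂ, (∀ j, ¬ p₂ j → u j = 0) → θ₂ * (star u ⬝ᵥ u).re ≤ (star u ⬝ᵥ H *ᵥ u).re)
    (hE : E < θ₁ + θ₂) (b d : m → ℂ) (X : Matrix m m ℂ)
    (hX : X = ∑ μ, ∑ ν, ((((hH.eigenvalues μ + hH.eigenvalues ν - E : ℝ) : ℂ))⁻¹ *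
        (star ⇑(hH.eigenvectorBasis μ) ⬝ᵥ b) * (star ⇑(hH.eigenvectorBasis ν) ⬝ᵥ d)) •
      vecMulVec (fun j => if p₁ j then (⇑(hH.eigenvectorBasis μ) : m → ℂ) j else 0)
        (fun j => if p₂ j then (⇑(hH.eigenvectorBasis ν) : m → ℂ) j else 0)) :
    H * X + X * Hᵀ - (E : ℂ) • X =
      vecMulVec (fun j => if p₁ j then b j else 0) (fun j => if p₂ j then d j else 0) := by
  -- apply the operator piecewise; the resonance-free scalar identity leaves `⟨u_μ,b⟩⟨u_ν,d⟩`
  have hlin : H * X + X * Hᵀ - (E : ℂ) • X =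
      ∑ μ, ∑ ν, ((star ⇑(hH.eigenvectorBasis μ) ⬝ᵥ b) * (star ⇑(hH.eigenvectorBasis ν) ⬝ᵥ d)) •
        vecMulVec (fun j => if p₁ j then (⇑(hH.eigenvectorBasis μ) : m → ℂ) j else 0)
          (fun j => if p₂ j then (⇑(hH.eigenvectorBasis ν) : m → ℂ) j else 0) := by
    rw [hX]
    simp only [Finset.mul_sum, Finset.sum_mul, Finset.smul_sum, ← Finset.sum_sub_distrib,
      ← Finset.sum_add_distrib]
    refine Finset.sum_congr rfl fun μ _ => Finset.sum_congr rfl fun ν _ => ?_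
    rw [Matrix.mul_smul, Matrix.smul_mul, smul_comm (E : ℂ), ← smul_add, ← smul_sub,
      sylvester_piece hH p₁ p₂ hK₁ hK₂ E μ ν, smul_smul,
      show ∀ (x y z : ℂ), x * y * z * (((hH.eigenvalues μ + hH.eigenvalues ν - E : ℝ) : ℂ)) =
        (y * z) * (x * (((hH.eigenvalues μ + hH.eigenvalues ν - E : ℝ) : ℂ))) from fun x y z => by ring,
      ← smul_smul, sylvester_piece_coef hH p₁ p₂ hK₁ hK₂ hθ₁ hθ₂ hE μ ν]
  rw [hlin]
  -- bilinearity and completeness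
  calc ∑ μ, ∑ ν, ((star ⇑(hH.eigenvectorBasis μ) ⬝ᵥ b) * (star ⇑(hH.eigenvectorBasis ν) ⬝ᵥ d)) •
          vecMulVec (fun j => if p₁ j then (⇑(hH.eigenvectorBasis μ) : m → ℂ) j else 0)
            (fun j => if p₂ j then (⇑(hH.eigenvectorBasis ν) : m → ℂ) j else 0)
      = ∑ μ, vecMulVec ((star ⇑(hH.eigenvectorBasis μ) ⬝ᵥ b) • (fun j => if p₁ j then (⇑(hH.eigenvectorBasis μ) : m → ℂ) j else 0))
          (∑ ν, (star ⇑(hH.eigenvectorBasis ν) ⬝ᵥ d) • (fun j => if p₂ j then (⇑(hH.eigenvectorBasis ν) : m → ℂ) j else 0)) := by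
        refine Finset.sum_congr rfl fun μ _ => ?_
        ext i j
        simp only [Matrix.sum_apply, Matrix.smul_apply, vecMulVec_apply, smul_eq_mul, Finset.sum_apply,
          Pi.smul_apply, Finset.mul_sum]
        refine Finset.sum_congr rfl fun ν _ => ?_
        ring
    _ = vecMulVec (∑ μ, (star ⇑(hH.eigenvectorBasis μ) ⬝ᵥ b) • (fun j => if p₁ j then (⇑(hH.eigenvectorBasis μ) : m → ℂ) j else 0))
          (∑ ν, (star ⇑(hH.eigenvectorBasis ν) ⬝ᵥ d) • (fun j => if p₂ j then (⇑(hH.eigenvectorBasis ν) : m → ℂ) j else 0)) := by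
        ext i j
        simp only [Matrix.sum_apply, vecMulVec_apply, Finset.sum_apply, Finset.sum_mul]
    _ = vecMulVec (fun j => if p₁ j then b j else 0) (fun j => if p₂ j then d j else 0) := by
        rw [sum_dotProduct_smul_truncEig hH p₁ b, sum_dotProduct_smul_truncEig hH p₂ d]

end Sylvester

end Generic

/-! ### Registered sub-goal of the crux item (stmt-HubbardSuperconductivity-8148) -/

set_option linter.style.longLine false in
/-- Registered sub-goal `dressHalfFilled_pairResolventSylvester` of the crux item (closed, `Type`-level restatement of
`sylvester_pairingSolution`): the block-projected spectral sum solves `H X + X Hᵀ - E X = b dᵀ`. [folklore] -/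
theorem dressHalfFilled_pairResolventSylvester : ∀ {m : Type} [Fintype m] [DecidableEq m] {H : Matrix m m ℂ} (hH : H.IsHermitian) (p₁ p₂ : m → Prop) [DecidablePred p₁] [DecidablePred p₂], (∀ j k, ¬ p₁ j → p₁ k → H j k = 0) → (∀ j k, ¬ p₂ j → p₂ k → H j k = 0) → ∀ {θ₁ θ₂ E : ℝ}, (∀ u : m → ℂ, (∀ j, ¬ p₁ j → u j = 0) → θ₁ * (star u ⬝ᵥ u).re ≤ (star u ⬝ᵥ Matrix.mulVec H u).re) → (∀ u : m → ℂ, (∀ j, ¬ p₂ j → u j = 0) → θ₂ * (star u ⬝ᵥ u).re ≤ (star u ⬝ᵥ Matrix.mulVec H u).re) → E < θ₁ + θ₂ → ∀ (b d : m → ℂ) (X : Matrix m m ℂ), X = ∑ μ, ∑ ν, ((((hH.eigenvalues μ + hH.eigenvalues ν - E : ℝ) : ℂ))⁻¹ * (star ⇑(hH.eigenvectorBasis μ) ⬝ᵥ b) * (star ⇑(hH.eigenvectorBasis ν) ⬝ᵥ d)) • Matrix.vecMulVec (fun j => if p₁ j then (⇑(hH.eigenvectorBasis μ) : m → ℂ)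 j else 0) (fun j => if p₂ j then (⇑(hH.eigenvectorBasis ν) : m → ℂ) j else 0) → H * X + X * Matrix.transpose H - (E : ℂ) • X = Matrix.vecMulVec (fun j => if p₁ j then b j else 0) (fun j => if p₂ j then d j else 0) :=
  by
  intro m _ _ H hH p₁ p₂ _ _ hK₁ hK₂ θ₁ θ₂ E hθ₁ hθ₂ hE b d X hX
  exact sylvester_pairingSolution hH p₁ p₂ hK₁ hK₂ hθ₁ hθ₂ hE b d X hX

end Summit.HubbardSuperconductivity.HubbardSuperconductivity.Theorems.LevyLogBootstrap

end
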